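import Summits.QuantumFields.YangMills.Theses.TransverseWardBL
import HarnessLib

/-!
# Route `TransverseWardBL`, support `ZeroModeProjection` (stmt-QuantumFields-23100): the harmonic (zero-mode)
projection of the co-closed part of the box form

Discrete Hodge bookkeeping on the torus `(ℤ/(M+1))⁴` (real plaquette 2-forms, genuine plaquettes `(x; i<j)`).
Write the box form `h_(N,M) = dα + u` with `u` co-closed and let `v(p) = u(p) − c(o(p))`, where
`c(o) = (∑_{q of orientation o} u(q)) / (M+1)⁴` is the mean of `u` over the `(M+1)⁴` plaquettes of orientation `o`.
Then
* `v` is co-closed — constant 2-forms are co-closed, because every orientation slice `∑_x (dφ)(x; i, j)` of an exact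
  form vanishes on the torus (translation invariance of `∑_x`);
* all six orientation sums of `v` vanish (there are exactly `#Site = (M+1)⁴` plaquettes per orientation);
* `|v|² ≤ |u|²` (`u = v + c∘o` with `v ⊥ c∘o`, an orthogonal projection);
* `|u − v|² = (M+1)⁴ ∑_o c(o)² = #B_N² / (M+1)⁴`: the orientation sums of `dα` vanish, so the orientation sums of `u`
  are those of the box form, i.e. `#B_N` for the orientation `(0,1)` (fibrewise count of `B_N` over the residues
  `mod M+1`) and `0` otherwise.

Free-hands width seat `ym-line-sfw-p2-w4` (cell ym-idea-1) for planner ym-idea-4 g9 (LINE g9-C «ZeroModeFreeAssembly»).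
THEOREMS ONLY; finite algebra on the torus cochain complex — nothing about the Yang–Mills mass gap is proved, and no rung
or crux is closed by this file.

References: folklore (discrete Hodge theory on the torus); M. P. Forsström, J. Lenells, F. Viklund, Ann. Inst. H. Poincaré
Probab. Stat. **58** (2022) §2 [ForsstromLenellsViklund2022] for the cochain conventions of `LatticeForm.td₁`.
-/

set_option autoImplicit false

noncomputable section

open Finset
open scoped BigOperators
open Literature.MathematicalPhysics.QuantumFieldTheory
open Literature.Probability.LatticeModels (box)

namespace Summit.QuantumFields.YangMills.Theorems.TransverseWardBL

/-- Every orientation slice of an exact 2-form has zero sum over the torus: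
`∑_x (td₁ φ)(x; i, j) = 0` (translation invariance of `∑_x`). [folklore] -/
theorem sum_td₁_slice_eq_zero (M : ℕ) (φ : Site 4 (M + 1) → Fin 4 → ℝ) (i j : Fin 4) :
    ∑ x : Site 4 (M + 1), LatticeForm.td₁ φ x i j = 0 := by
  simp only [LatticeForm.td₁, Finset.sum_sub_distrib, Finset.sum_add_distrib]
  have h1 : ∑ x : Site 4 (M + 1), φ (x + LatticeForm.te i) j = ∑ x : Site 4 (M + 1), φ x j :=
    Fintype.sum_equiv (Equiv.addRight (LatticeForm.te i)) _ _ fun _ => rfl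
  have h2 : ∑ x : Site 4 (M + 1), φ (x + LatticeForm.te j) i = ∑ x : Site 4 (M + 1), φ x i :=
    Fintype.sum_equiv (Equiv.addRight (LatticeForm.te j)) _ _ fun _ => rfl
  rw [h1, h2]
  ring

/-- An orientation-sliced plaquette sum is the sum over base points:
`∑_q [o(q) = o] g(q) = ∑_x g(x; o)`. [folklore] -/
theorem sum_ite_orient_eq (M : ℕ) (g : Plaquette 4 (M + 1) → ℝ) (o : {p : Fin 4 × Fin 4 // p.1 < p.2}) :
    (∑ q : Plaquette 4 (M + 1), (if q.2 = o then g q else 0)) = ∑ x : Site 4 (M + 1), g (x, o) := by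
  rw [Fintype.sum_prod_type]
  refine Finset.sum_congr rfl fun x _ => ?_
  rw [Finset.sum_ite_eq' Finset.univ o (fun o' => g (x, o'))]
  simp only [Finset.mem_univ, if_true]

/-- Pairing an orientation-constant 2-form `p ↦ c(o(p))` with an exact 2-form gives zero:
`∑_p c(o(p)) (td₁ φ)(p) = 0`. [folklore] -/
theorem sum_orientConst_mul_res_td₁ (M : ℕ) (c : {p : Fin 4 × Fin 4 // p.1 < p.2} → ℝ)
    (φ : Site 4 (M + 1) → Fin 4 → ℝ) :
    ∑ p : Plaquette 4 (M + 1), c p.2 * LatticeForm.res (LatticeForm.td₁ φ) p = 0 := by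
  rw [Fintype.sum_prod_type, Finset.sum_comm]
  refine Finset.sum_eq_zero fun o _ => ?_
  simp only [LatticeForm.res]
  rw [← Finset.mul_sum, sum_td₁_slice_eq_zero, mul_zero]

/-- The orientation slice of an exact 2-form over the genuine plaquettes vanishes:
`∑_x (td₁ φ)(x; o) = 0`. [folklore] -/
theorem sum_res_td₁_slice_eq_zero (M : ℕ) (φ : Site 4 (M + 1) → Fin 4 → ℝ)
    (o : {p : Fin 4 × Fin 4 // p.1 < p.2}) :
    ∑ x : Site 4 (M + 1), LatticeForm.res (LatticeForm.td₁ φ) (x, o) = 0 := by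
  simp only [LatticeForm.res]
  exact sum_td₁_slice_eq_zero M φ _ _

/-- The torus `(ℤ/(M+1))⁴` has `(M+1)⁴` sites (as a real number). [folklore] -/
theorem card_site_real (M : ℕ) : (Fintype.card (Site 4 (M + 1)) : ℝ) = ((M : ℝ) + 1) ^ 4 := by
  rw [Fintype.card_fun, ZMod.card, Fintype.card_fin]
  push_cast
  ring

/-- Fibrewise count: the residues `mod M+1` partition the box, `∑_z #{x ∈ B_N : x ≡ z} = #B_N`. [folklore] -/
theorem sum_card_box_fibre (M N : ℕ) :
    ∑ z : Site 4 (M + 1), (((box 4 N).filter (fun x => (fun i => ((x i : ℤ) : ZMod (M + 1))) = z)).card : ℝ) =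
      ((box 4 N).card : ℝ) := by
  rw [← Nat.cast_sum, ← Finset.card_eq_sum_card_fiberwise fun x _ => Finset.mem_univ _]

/-- **`ZeroModeProjection`** (item stmt-QuantumFields-23100), BY NAME: for `h_(N,M) = dα + u` with `u` co-closed, the
orientation-mean-free part `v = u − c∘o` is co-closed, has vanishing orientation sums, `|v|² ≤ |u|²`, and
`|u − v|² ≤ #B_N² / (M+1)⁴`. [folklore] -/
theorem zeroModeProjection_proof : Summit.QuantumFields.YangMills.Theses.TransverseWardBL.ZeroModeProjection := by
  unfold Summit.QuantumFields.YangMills.Theses.TransverseWardBL.ZeroModeProjection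
  intro M N α u hsplit hcc
  simp only
  -- the orientation means
  set c : {p : Fin 4 × Fin 4 // p.1 < p.2} → ℝ :=
    fun o => (∑ q : Plaquette 4 (M + 1), (if q.2 = o then u q else 0)) / (((M : ℝ) + 1) ^ 4) with hc_def
  have key : ∀ p : Plaquette 4 (M + 1),
      (∑ q : Plaquette 4 (M + 1), (if q.2 = p.2 then u q else 0)) / (((M : ℝ) + 1) ^ 4) = c p.2 :=
    fun p => rfl
  simp only [key]
  have hM : (((M : ℝ) + 1) ^ 4) ≠ 0 := by positivity
  -- the orientation sums of `u`
  have hc : ∀ o : {p : Fin 4 × Fin 4 // p.1 < p.2},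
      c o = (∑ x : Site 4 (M + 1), u (x, o)) / (((M : ℝ) + 1) ^ 4) := by
    intro o
    simp only [hc_def, sum_ite_orient_eq]
  -- (C2) orientation sums of `v` vanish, in base-point form
  have hslice : ∀ o : {p : Fin 4 × Fin 4 // p.1 < p.2},
      ∑ x : Site 4 (M + 1), (u (x, o) - c o) = 0 := by
    intro o
    rw [Finset.sum_sub_distrib, Finset.sum_const, Finset.card_univ, nsmul_eq_mul, card_site_real, hc o,
      mul_div_cancel₀ _ hM, sub_self]
  refine ⟨fun e => ?_, fun o => ?_, ?_, ?_⟩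
  · -- (C1) `v` is co-closed
    simp only [sub_mul, Finset.sum_sub_distrib, hcc e, sum_orientConst_mul_res_td₁, sub_zero]
  · -- (C2)
    rw [sum_ite_orient_eq M (fun q => u q - c q.2) o]
    exact hslice o
  · -- (C3) orthogonal projection
    have hcross : ∑ p : Plaquette 4 (M + 1), (u p - c p.2) * c p.2 = 0 := by
      rw [Fintype.sum_prod_type, Finset.sum_comm]
      refine Finset.sum_eq_zero fun o _ => ?_
      simp only
      rw [← Finset.sum_mul, hslice o, zero_mul]
    have hexp : ∑ p : Plaquette 4 (M + 1), (u p) ^ 2 =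
        ∑ p : Plaquette 4 (M + 1), (u p - c p.2) ^ 2 + 2 * ∑ p : Plaquette 4 (M + 1), (u p - c p.2) * c p.2 +
          ∑ p : Plaquette 4 (M + 1), (c p.2) ^ 2 := by
      rw [Finset.mul_sum, ← Finset.sum_add_distrib, ← Finset.sum_add_distrib]
      exact Finset.sum_congr rfl fun p _ => by ring
    rw [hexp, hcross, mul_zero, add_zero]
    exact le_add_of_nonneg_right (Finset.sum_nonneg fun p _ => sq_nonneg _)
  · -- (C4) the harmonic part: `|c∘o|² = #B_N² / (M+1)⁴`
    have hu : ∀ p : Plaquette 4 (M + 1),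
        u p = (if p.2.1 = ((0 : Fin 4), (1 : Fin 4)) then
            (((box 4 N).filter (fun x => (fun i => ((x i : ℤ) : ZMod (M + 1))) = p.1)).card : ℝ) else 0) -
          LatticeForm.res (LatticeForm.td₁ α) p := fun p => by rw [hsplit p]; ring
    set o01 : {p : Fin 4 × Fin 4 // p.1 < p.2} := ⟨((0 : Fin 4), (1 : Fin 4)), by decide⟩ with ho01_def
    have hcval : ∀ o : {p : Fin 4 × Fin 4 // p.1 < p.2},
        c o = if o = o01 then ((box 4 N).card : ℝ) / (((M : ℝ) + 1) ^ 4) else 0 := by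
      intro o
      rw [hc o]
      simp only [hu, Finset.sum_sub_distrib, sum_res_td₁_slice_eq_zero, sub_zero]
      by_cases ho : o = o01
      · subst ho
        rw [if_pos rfl]
        have hval : ((o01 : {p : Fin 4 × Fin 4 // p.1 < p.2}) : Fin 4 × Fin 4) = ((0 : Fin 4), (1 : Fin 4)) := rfl
        simp only [hval, if_true]
        rw [sum_card_box_fibre]
      · have ho' : (o : Fin 4 × Fin 4) ≠ ((0 : Fin 4), (1 : Fin 4)) := fun h => ho (Subtype.ext h)
        rw [if_neg ho]
        simp only [ho', if_false, Finset.sum_const_zero, zero_div]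
    have hsq : ∑ p : Plaquette 4 (M + 1), (u p - (u p - c p.2)) ^ 2 =
        ((M : ℝ) + 1) ^ 4 * ∑ o : {p : Fin 4 × Fin 4 // p.1 < p.2}, (c o) ^ 2 := by
      rw [Fintype.sum_prod_type]
      simp only [sub_sub_cancel]
      rw [Finset.sum_const, Finset.card_univ, nsmul_eq_mul, card_site_real]
    have hsum : ∑ o : {p : Fin 4 × Fin 4 // p.1 < p.2}, (c o) ^ 2 =
        (((box 4 N).card : ℝ) / (((M : ℝ) + 1) ^ 4)) ^ 2 := by
      rw [Finset.sum_eq_single o01]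
      · rw [hcval o01, if_pos rfl]
      · intro o _ ho
        rw [hcval o, if_neg ho]
        ring
      · intro h
        exact absurd (Finset.mem_univ _) h
    rw [hsq, hsum, div_pow, ← mul_div_assoc, sq (((M : ℝ) + 1) ^ 4), mul_div_mul_left _ _ hM]

end Summit.QuantumFields.YangMills.Theorems.TransverseWardBL

end
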